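import Summits.ValiantsHypothesis.ValiantsHypothesis.Theorems.MonotoneRestorationOrbitRestorationQPWaringJennrich
import Summits.ValiantsHypothesis.ValiantsHypothesis.Theorems.MonotoneRestorationOrbitRestorationQPValueOrbitProductTerms
import HarnessLib

/-!
# A_∞ on the Jennrich stratum of ΣΛΣ: independent Waring decompositions are orbit-restorable

Route MonotoneRestoration, crux `OrbitRestorationQP` (stmt-ValiantsHypothesis-18293), line `depth-three-rung`,
stub A_∞ `stub_sigmaPiSigmaValue` (ΣΠΣ restoration with UNBOUNDED top fan-in, value currency
`QPOrbitRestorable`).  Namespace `Summit.ValiantsHypothesis.ValiantsHypothesis.Theorems.WaringJennrich`.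

Beyond bounded top fan-in the rank bounds behind `stub_sigmaPiSigmaKValue` are vacuous; the workfile
`Cruxes/OrbitRestorationQP/Lines/depth-three-rung-stubA-bounded-fanin.md` §9 proposes IDENTIFIABILITY as the
mechanism: a unique decomposition is permuted by the stabiliser of `f`, so its pieces have small orbits.
With Jennrich's theorem (`…WaringJennrich.lean`) this file proves the first unbounded-fan-in sub-rung of A_∞:

* `ren_lin` — the diagonal action on linear forms; `linearIndependent_perm` — it preserves independence;
* `orbit_lin_subset` / `ncard_orbit_lin_le` — **if `f = Σ_{i<r} a_i ℓ_{w_i}^d` is diagonally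
  `Sym(Fin n)`-invariant with `w` linearly independent, `a_i ≠ 0`, `d ≥ 3`, then every form `ℓ_{w_j}` has
  orbit of size `≤ r·d`** (its images are `c·ℓ_{w_k}` with `c^d = a_k/a_j`);
* `qpOrbitRestorable_of_independentWaring` — hence `QPOrbitRestorable (c+5) n f` as soon as
  `r·d ≤ 2^((log₂ n + c)^c)` (landed glue `ValueProducts.qpOrbitRestorable_of_affineProductTerms`);
* `sigmaLambdaSigma_jennrich_restoration` — **the family statement in the format of the rung: every
  matrix-symmetric family written at each level as a sum of `≤ n^c₀+c₀` nonzero multiples of `d`-th powers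
  (`3 ≤ d ≤ n^c₀+c₀`) of LINEARLY INDEPENDENT linear forms is quasi-polynomially orbit-restorable**, with NO
  bound on the top fan-in beyond the polynomial one.

Honest label: a sub-rung of A_∞ (ΣΛΣ, identifiable case); A_∞ itself (non-identifiable symmetric
families, continuous families of minimal decompositions) stays open; VP ≠ VNP is not touched. [folklore]
-/

noncomputable section

open scoped Classical

-- `Summit.ValiantsHypothesis.ValiantsHypothesis.…` is the tree's single-conjunct layout (Sub = Summit).
set_option linter.dupNamespace false

namespace Summit.ValiantsHypothesis.ValiantsHypothesis.Theorems

namespace WaringJennrich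

open MvPolynomial Finset OrbitRestorationQPDepthThreeRung

variable {n : ℕ}

/-! ### The diagonal action on linear forms -/

/-- `ren σ` of a linear form is the linear form with permuted coefficient vector. [folklore] -/
theorem ren_lin (σ : Equiv.Perm (Fin n)) (w : (Fin n × Fin n) → ℂ) :
    ren σ (lin w) = lin (fun x => w (σ⁻¹ • x)) := by
  simp only [lin, map_sum, map_mul, ren_C, ren_X]
  symm
  refine (Equiv.sum_comp (MulAction.toPerm σ : Equiv.Perm (Fin n × Fin n))
    (fun y => C (w (σ⁻¹ • y)) * MvPolynomial.X y)).symm.trans ?_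
  refine Finset.sum_congr rfl fun x _ => ?_
  simp [MulAction.toPerm_apply, inv_smul_smul]

/-- Permuting coordinates preserves linear independence of coefficient vectors. [folklore] -/
theorem linearIndependent_perm {ι : Type*} (σ : Equiv.Perm (Fin n)) {w : ι → (Fin n × Fin n) → ℂ}
    (hw : LinearIndependent ℂ w) : LinearIndependent ℂ fun i => fun x => w i (σ⁻¹ • x) := by
  have h : (fun i => fun x => w i (σ⁻¹ • x)) =
      (LinearMap.funLeft ℂ ℂ fun x : Fin n × Fin n => σ⁻¹ • x) ∘ w := by
    funext i x; rfl
  rw [h]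
  refine hw.map' _ (LinearMap.ker_eq_bot.mpr ?_)
  exact LinearMap.funLeft_injective_of_surjective _ _ _ (MulAction.surjective _)

/-! ### Orbits of the forms of an invariant independent Waring decomposition -/

section Orbit

variable {r d : ℕ} (w : Fin r → (Fin n × Fin n) → ℂ) (a : Fin r → ℂ)

/-- **The orbit of each form of an invariant independent Waring decomposition is finite and explicit**:
`ren σ ℓ_{w_j} = c · ℓ_{w_k}` for some `k` and some `d`-th root `c` of `a_k / a_j`. [folklore] -/
theorem orbit_lin_subset (hd : 3 ≤ d) (hw : LinearIndependent ℂ w) (ha : ∀ i, a i ≠ 0)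
    (hfix : ∀ σ : Equiv.Perm (Fin n),
      ren σ (∑ i, C (a i) * lin (w i) ^ d) = ∑ i, C (a i) * lin (w i) ^ d) (j : Fin r) :
    (Set.range fun σ : Equiv.Perm (Fin n) => ren σ (lin (w j))) ⊆
      ↑((Finset.univ : Finset (Fin r)).biUnion fun k =>
        ((Polynomial.nthRoots d (a k / a j)).toFinset.image fun c => C c * lin (w k))) := by
  rintro _ ⟨σ, rfl⟩
  have h := hfix σ
  simp only [map_sum, map_mul, ren_C, map_pow, ren_lin] at h
  obtain ⟨k, c, hinj, hkc, hcoef⟩ :=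
    jennrich_terms w a (fun i => fun x => w i (σ⁻¹ • x)) a hw ha hd le_rfl
      (linearIndependent_perm σ hw) h.symm
  simp only [Finset.coe_biUnion, Finset.coe_univ, Set.mem_univ, Set.iUnion_true, Set.mem_iUnion,
    Finset.coe_image, Set.mem_image, Finset.mem_coe, Multiset.mem_toFinset]
  refine ⟨k j, c j, ?_, ?_⟩
  · rw [Polynomial.mem_nthRoots (by omega), eq_div_iff (ha j), mul_comm]
    exact hcoef j
  · rw [ren_lin, hkc j, lin_smul]

/-- **Orbit bound**: every form of an invariant independent Waring decomposition with `r` terms of degree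
`d ≥ 3` has at most `r · d` images under the diagonal action. [folklore] -/
theorem ncard_orbit_lin_le (hd : 3 ≤ d) (hw : LinearIndependent ℂ w) (ha : ∀ i, a i ≠ 0)
    (hfix : ∀ σ : Equiv.Perm (Fin n),
      ren σ (∑ i, C (a i) * lin (w i) ^ d) = ∑ i, C (a i) * lin (w i) ^ d) (j : Fin r) :
    (Set.range fun σ : Equiv.Perm (Fin n) => ren σ (lin (w j))).ncard ≤ r * d := by
  refine (Set.ncard_le_ncard (orbit_lin_subset w a hd hw ha hfix j) (Finset.finite_toSet _)).trans ?_
  rw [Set.ncard_coe_finset]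
  refine (Finset.card_biUnion_le).trans ?_
  calc ∑ k : Fin r, ((Polynomial.nthRoots d (a k / a j)).toFinset.image fun c => C c * lin (w k)).card
      ≤ ∑ _k : Fin r, d := Finset.sum_le_sum fun k _ =>
        Finset.card_image_le.trans ((Multiset.toFinset_card_le _).trans (Polynomial.card_nthRoots _ _))
    _ = r * d := by rw [Finset.sum_const, Finset.card_univ, Fintype.card_fin, smul_eq_mul]

end Orbit

/-! ### Restorability -/

/-- The forms of this file are the tree's `affineForm` with zero constant term. [folklore] -/
theorem affineForm_eq_lin {τ ι : Type} [Fintype τ] [Fintype ι] (w : τ → (Fin n × Fin n) → ℂ) (s : τ)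
    (i : ι) : ValueProducts.affineForm (fun _ _ => (0 : ℂ)) (fun s _ => w s) s i = lin (w s) := by
  rw [ValueProducts.affineForm, map_zero, zero_add, lin]

/-- **A_∞ on the Jennrich stratum, one level**: a diagonally `Sym(Fin n)`-invariant
`f = Σ_{i<r} a_i ℓ_{w_i}^d` with linearly independent `w`, nonzero `a_i`, `d ≥ 3` and
`r·d ≤ 2^((log₂ n + c)^c)` is `QPOrbitRestorable (c+5) n f`. [folklore] -/
theorem qpOrbitRestorable_of_independentWaring {c r d : ℕ} (hd : 3 ≤ d)
    (w : Fin r → (Fin n × Fin n) → ℂ) (hw : LinearIndependent ℂ w) (a : Fin r → ℂ) (ha : ∀ i, a i ≠ 0)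
    (hB : r * d ≤ 2 ^ ((Nat.log 2 n + c) ^ c)) {f : MvPolynomial (Fin n × Fin n) ℂ}
    (hf : f = ∑ i, C (a i) * lin (w i) ^ d) (hfix : ∀ σ : Equiv.Perm (Fin n), ren σ f = f) :
    QPOrbitRestorable (c + 5) n f := by
  have hfix' : ∀ σ : Equiv.Perm (Fin n),
      ren σ (∑ i, C (a i) * lin (w i) ^ d) = ∑ i, C (a i) * lin (w i) ^ d := by
    intro σ; rw [← hf]; exact hfix σ
  have horb := ncard_orbit_lin_le w a hd hw ha hfix'
  refine ValueProducts.qpOrbitRestorable_of_affineProductTerms (τ := Fin r) (ι := Fin d)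
    (fun _ _ => (0 : ℂ)) (fun s _ => w s) a (fun s i => ?_) (fun s => ?_) ?_ hfix
  · rw [affineForm_eq_lin]
    exact (horb s).trans hB
  · have hfac : ∀ σ : Equiv.Perm (Fin n),
        ((Finset.univ : Finset (Fin d)).val.map
          (ValueProducts.affineForm (fun _ _ => (0 : ℂ)) (fun s _ => w s) s)).map (ren σ) =
        (Finset.univ : Finset (Fin d)).val.map (fun _ => ren σ (lin (w s))) := by
      intro σ
      rw [Multiset.map_map]
      refine Multiset.map_congr rfl fun i _ => ?_
      simp only [Function.comp_apply, affineForm_eq_lin]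
    refine (TermCircuit.ncard_range_le_of_factor _ (fun σ : Equiv.Perm (Fin n) => ren σ (lin (w s)))
      (fun q => (Finset.univ : Finset (Fin d)).val.map fun _ => q) hfac).trans ?_
    exact (horb s).trans hB
  · rw [hf]
    refine Finset.sum_congr rfl fun s _ => ?_
    rw [Finset.prod_congr rfl fun i _ => affineForm_eq_lin w s i, Finset.prod_const, Finset.card_univ,
      Fintype.card_fin]

/-- Arithmetic: `(n^c₀ + c₀)² ≤ 2^((log₂ n + c)^c)` uniformly in `n` (`c = 2c₀ + 2`). [folklore] -/
theorem sq_polyBound_le_qp (c₀ : ℕ) : ∃ c : ℕ, ∀ n : ℕ, (n ^ c₀ + c₀) * (n ^ c₀ + c₀) ≤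
    2 ^ ((Nat.log 2 n + c) ^ c) := by
  refine ⟨2 * c₀ + 2, fun n => ?_⟩
  have hL : n < 2 ^ (Nat.log 2 n + 1) := Nat.lt_pow_succ_log_self Nat.one_lt_two n
  generalize Nat.log 2 n = L at hL ⊢
  have h1 : n ^ c₀ ≤ 2 ^ ((L + 1) * c₀) := by
    rw [pow_mul]; exact Nat.pow_le_pow_left hL.le c₀
  have h2 : c₀ < 2 ^ c₀ := Nat.lt_two_pow_self
  have h4 : 1 ≤ 2 ^ ((L + 1) * c₀) := Nat.one_le_two_pow
  have h3 : n ^ c₀ + c₀ ≤ 2 ^ ((L + 1) * c₀ + c₀) := by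
    rw [pow_add]
    nlinarith
  have e1 : (L + (2 * c₀ + 2)) ^ 2 ≤ (L + (2 * c₀ + 2)) ^ (2 * c₀ + 2) :=
    Nat.pow_le_pow_right (by omega) (by omega)
  have e2 : 2 * ((L + 1) * c₀ + c₀) ≤ (L + (2 * c₀ + 2)) ^ 2 := by nlinarith
  calc (n ^ c₀ + c₀) * (n ^ c₀ + c₀)
      ≤ 2 ^ ((L + 1) * c₀ + c₀) * 2 ^ ((L + 1) * c₀ + c₀) := Nat.mul_le_mul h3 h3
    _ = 2 ^ (2 * ((L + 1) * c₀ + c₀)) := by rw [← pow_add]; ring_nf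
    _ ≤ 2 ^ ((L + (2 * c₀ + 2)) ^ (2 * c₀ + 2)) := Nat.pow_le_pow_right (by norm_num) (e2.trans e1)

/-- **A_∞ ON THE JENNRICH STRATUM OF ΣΛΣ (family form, the rung's format).**  Every matrix-symmetric
family `f` which at every level `n` is a sum of at most `n^c₀ + c₀` nonzero multiples of `d_n`-th powers,
`3 ≤ d_n ≤ n^c₀ + c₀`, of LINEARLY INDEPENDENT linear forms is quasi-polynomially orbit-restorable — an
unbounded-top-fan-in instance of `stub_sigmaPiSigmaValue` (A_∞) of line `depth-three-rung`, by
identifiability (Jennrich) instead of rank bounds. [folklore] -/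
theorem sigmaLambdaSigma_jennrich_restoration (f : (n : ℕ) → MvPolynomial (Fin n × Fin n) ℂ)
    (hsym : IsMatrixSymmetric f)
    (h : ∃ c₀ : ℕ, ∀ n : ℕ, ∃ (r d : ℕ) (w : Fin r → (Fin n × Fin n) → ℂ) (a : Fin r → ℂ),
      3 ≤ d ∧ r ≤ n ^ c₀ + c₀ ∧ d ≤ n ^ c₀ + c₀ ∧ LinearIndependent ℂ w ∧ (∀ i, a i ≠ 0) ∧
        f n = ∑ i, C (a i) * lin (w i) ^ d) :
    ∃ c : ℕ, ∀ n : ℕ, QPOrbitRestorable c n (f n) := by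
  obtain ⟨c₀, hc₀⟩ := h
  obtain ⟨c, hc⟩ := sq_polyBound_le_qp c₀
  refine ⟨c + 5, fun n => ?_⟩
  obtain ⟨r, d, w, a, hd, hr, hdle, hw, ha, hf⟩ := hc₀ n
  refine qpOrbitRestorable_of_independentWaring hd w hw a ha ?_ hf
    (ValueOrbit.ren_eq_of_matrixSymmetric (hsym n))
  exact (Nat.mul_le_mul hr hdle).trans (hc n)

end WaringJennrich

end Summit.ValiantsHypothesis.ValiantsHypothesis.Theorems

end
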